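import Summits.CriticalPhenomena.SAWScalingLimit.Theorems.SAWTotalPositivityCriticalBubbleBoundJoinLedger
import Summits.CriticalPhenomena.SAWScalingLimit.Theorems.SAWTotalPositivityCriticalBubbleBoundJoinRooted
import Summits.CriticalPhenomena.SAWScalingLimit.Theorems.SAWTotalPositivityCriticalBubbleBoundDockingReduction

/-!
# The abstract ledger door of the JOIN-MASS programme (stub `criticalBubbleBound_of_ledger` of line
`docking-census-joining`, crux stmt-CriticalPhenomena-7117
`Summit.CriticalPhenomena.SAWScalingLimit.Theses.SAWTotalPositivity.CriticalBubbleBound`)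

The exponent ledger `θ - 1 = κ + π` (the landed bootstrap `Docking.stub_ledgerBootstrap`, a theorem
about an arbitrary nonnegative sequence) CLOSES the crux as soon as `κ + π > 2`.  Fed with the shifted
class sequence `t := jterm` (a priori `jterm n ≤ exp (K √n)`, `Join.jterm_le_exp`), an entropy mass `D`
with `c 2^{(κ-1) i} (R'_i)² ≤ D i` for `i ≥ i₀` (`R'_i := blockMass jterm i`), an injection
`D i ≤ K₁ U i` and a rarity mass `U` with `U i ≤ C (i+1)^b 2^{-π i} R'_{i+1} + C 2^{-4 i}`, the ledger
gives `R'_i ≤ C' 2^{s i}` for every `s > 1 - (κ + π)` with `s ≥ -3/2`.  When `κ + π > 2` one may take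
`s < -1` (here `s := max (-5/4) ((1 - (κ + π) - 1) / 2)`), the block transfer
`Join.blockMass_term_le_of_jterm` turns this into `blockMass term i ≤ C'' 2^{(s+1) i}` with `s + 1 < 0`
for the crux's ROOTED blocks, the bubble series `Σ_n c_n(0,e₀) x_cⁿ` is finite
(`Docking.tsum_term_ne_top`), and the landed one-number normal form
(`Negative.criticalBubbleBound_iff_bubble_e₀_ne_top`, `Negative.latticeKernel_zero_eq_tsum_countAt`)
is the crux.

In the programme `κ = 3/2` is proved (docking entropy of tall classes, `Join.Dent_ge`) and `π = 0` is
proved for GLOBAL join plaquettes (Hammond's Prop. 4.5); the MACROSCOPIC door instantiates the present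
theorem with `U = Umac` (macroscopic global join plaquettes), where any rarity exponent `π > 1/2` would
close the crux.  This file is the sorry-free abstract door; it does not close the crux item.
-/

noncomputable section

open Literature.Probability.LatticeModels
open Literature.Probability.RandomPlanarGeometry Literature.Probability.RandomPlanarGeometry.SAW
open scoped BigOperators ENNReal
open Summit.CriticalPhenomena.SAWScalingLimit.Theorems.CriticalBubbleBound.Negative (e₀)
open Summit.CriticalPhenomena.SAWScalingLimit.Theorems.CriticalBubbleBound.Docking

namespace Summit.CriticalPhenomena.SAWScalingLimit.Theorems.CriticalBubbleBound.Join

/-- **The abstract ledger door** (registered stub `criticalBubbleBound_of_ledger`): if the shifted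
class sequence `jterm` admits an entropy mass `D` with exponent `κ ≥ 0`
(`c 2^{(κ-1) i} (blockMass jterm i)² ≤ D i` for `i ≥ i₀`), an injection `D i ≤ K₁ U i` and a rarity
mass `U` with exponent `π` (`U i ≤ C (i+1)^b 2^{-π i} blockMass jterm (i+1) + C 2^{-4 i}`), and
`κ + π > 2`, then `CriticalBubbleBound` holds: the ledger `Docking.stub_ledgerBootstrap` at an exponent
`s` with `1 - (κ + π) < s`, `-3/2 ≤ s`, `s < -1` gives `blockMass jterm i ≤ C' 2^{s i}`, the block
transfer gives `blockMass term i ≤ C'' 2^{(s+1) i}`, `s + 1 < 0`, and geometric block decay makes the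
bubble series finite (one-number normal form). [cite: Hammond2015SAPJoining, §4] -/
theorem criticalBubbleBound_of_ledger : ∀ (κ π : ℝ) (D U : ℕ → ℝ), 0 ≤ κ → 2 < κ + π → (∃ c : ℝ, 0 < c ∧ ∃ i₀ : ℕ, ∀ i : ℕ, i₀ ≤ i → c * (2 : ℝ) ^ ((κ - 1) * (i : ℝ)) * blockMass jterm i ^ 2 ≤ D i) → (∃ K₁ : ℝ, 0 < K₁ ∧ ∀ i : ℕ, D i ≤ K₁ * U i) → (∃ C b : ℝ, ∀ i : ℕ, U i ≤ C * ((i : ℝ) + 1) ^ b * (2 : ℝ) ^ (-π * (i : ℝ)) * blockMass jterm (i + 1) + C * (2 : ℝ) ^ (-(4 : ℝ) * (i : ℝ))) → Summit.CriticalPhenomena.SAWScalingLimit.Theses.SAWTotalPositivity.CriticalBubbleBound := by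
  intro κ π D U hκ hsum hDock hD hU
  obtain ⟨c, hc, i₀, hDock⟩ := hDock
  obtain ⟨C, b, hU⟩ := hU
  -- docking entropy in the ledger's shape (`blockMass jterm i` unfolded to the dyadic block sum)
  have hDock' : ∀ i : ℕ, i₀ ≤ i →
      c * (2 : ℝ) ^ ((κ - 1) * (i : ℝ)) *
        (∑ n ∈ Finset.Ico (2 ^ i) (2 ^ (i + 1)), jterm n) ^ 2 ≤ D i := by
    intro i hi
    rw [← blockMass_eq]
    exact hDock i hi
  -- rarity in the ledger's shape
  have hU' : ∀ i : ℕ, U i ≤ C * ((i : ℝ) + 1) ^ b * (2 : ℝ) ^ (-π * (i : ℝ)) *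
      (∑ n ∈ Finset.Ico (2 ^ (i + 1)) (2 ^ (i + 1 + 1)), jterm n)
        + C * (2 : ℝ) ^ (-(4 : ℝ) * (i : ℝ)) := by
    intro i
    rw [← blockMass_eq]
    exact hU i
  -- the exponent: `1 - (κ + π) < s`, `-3/2 ≤ s`, `s + 1 < 0` (possible since `κ + π > 2`)
  obtain ⟨s, hs1, hs2, hs3⟩ : ∃ s : ℝ, 1 - (κ + π) < s ∧ -(3 : ℝ) / 2 ≤ s ∧ s + 1 < 0 := by
    refine ⟨max (-(5 : ℝ) / 4) ((1 - (κ + π) + (-1)) / 2), ?_, ?_, ?_⟩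
    · exact lt_max_of_lt_right (by linarith)
    · exact le_max_of_le_left (by norm_num)
    · have h1 : (-(5 : ℝ) / 4) + 1 < 0 := by norm_num
      have h2 : (1 - (κ + π) + (-1)) / 2 + 1 < 0 := by linarith
      rcases le_total (-(5 : ℝ) / 4) ((1 - (κ + π) + (-1)) / 2) with h | h
      · rw [max_eq_right h]
        exact h2
      · rw [max_eq_left h]
        exact h1
  -- the ledger: `blockMass jterm i ≤ C' 2^{s i}`
  obtain ⟨C', hC'⟩ := stub_ledgerBootstrap κ π hκ jterm D U jterm_nonneg jterm_le_exp hD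
    ⟨c, hc, i₀, hDock'⟩ ⟨C, b, hU'⟩ s hs1 hs2
  have hC'b : ∀ i : ℕ, blockMass jterm i ≤ C' * (2 : ℝ) ^ (s * (i : ℝ)) := fun i => by
    rw [blockMass_eq]
    exact hC' i
  -- block transfer to the crux's rooted blocks: `blockMass term i ≤ C'' 2^{(s+1) i}`, `s + 1 < 0`
  obtain ⟨C'', hC''⟩ := blockMass_term_le_of_jterm C' s hC'b
  -- one-number normal form and geometric block decay
  rw [Negative.criticalBubbleBound_iff_bubble_e₀_ne_top, Negative.bubble,
    Negative.latticeKernel_zero_eq_tsum_countAt]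
  exact tsum_term_ne_top ⟨C'', s + 1, hs3, hC''⟩

end Summit.CriticalPhenomena.SAWScalingLimit.Theorems.CriticalBubbleBound.Join

end
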